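import Mathlib
import HarnessLib
import Summits.HubbardSuperconductivity.HubbardSuperconductivity.Theorems.KLProgrammeKLRegimeSplitFrameFn
import Summits.HubbardSuperconductivity.HubbardSuperconductivity.Theorems.KLProgrammeKLRegimeCountertermFlatCutoffGrid

/-!
# Route `KLProgramme`, crux K3 — Δ23 / (R-I) core, part 2: the POINTWISE API of the de-interpolated G-extension `klFrameExtFn` and the
# lattice bridges to the status-quo objects (`klFlatCutoff`, `klFrameExtG`, `nambuXiCT`)

Cell gate-hubbard-kl, seat p2 (g6); continues `…KLRegimeSplitFrameFn` (p479563).  Needed verbatim under (R-I) and under (R-I-min) (plan g11 Δ23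
ruling 2026-08-27T00:30:14Z + addendum (H)); replaces, for FUNCTIONS, the value-level facts child 2's files used about `klFrameExtG`
(`…CountertermMuFlow/MuFlowExt/FlatCutoffGrid`):

* §1 lattice bridges: `freeBandFn (p_k) = torusBand L k`, `klFlatCutoffFn μ (p_k) = klFlatCutoff L μ k`, `polarAngle (centredRep p_k) = momentumAngle L k`,
  `klFrameExtFn μ f (p_k) =` the lattice datum of `klFrameExtG L μ f`, hence **`toTrigPoly L (klFrameExtFn μ f) = klFrameExtG L μ f`** (the old piece IS
  the model's view of the new one) and `nambuXiCT L μ (toTrigPoly L K.eval) = nambuXiCT L μ K` (a `TrigPolyC4v` frame and its re-interpolated view have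
  the same band — every model object reads `nambuXiCT` only);
* §2 the cutoff on continuum momenta: `= 1` on the flat tube `|ε(p) − μ| ≤ klFlatR`, `= 0` off the doubled tube, values in `[0,1]`;
* §3 pointwise algebra of `klFrameExtFn`: `= f (polarAngle p̃)` on the flat tube, `= mean f` off the doubled tube, constants, `add/neg/sub/const_mul`
  (linearity under `IntervalIntegrable` of the profiles on `[0, 2π]`, as for `klAngularMean`), the mean-free split, and the sup bound
  `|klFrameExtFn μ f p − mean f| ≤ |f (polarAngle p̃) − mean f|`.

Proofs only (no new definitions); nothing is asserted about the model.  The `D₄`-symmetry / smoothness of `klFrameExtFn μ f` (under the symmetries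
and regularity of `f`) is k3c3-p1's «symbol side» file (STATUS 2026-08-27T00:38:03Z) and is not duplicated here.
-/

noncomputable section

namespace Summit.HubbardSuperconductivity.HubbardSuperconductivity.Theorems.KLRegimeSplit

set_option linter.dupNamespace false -- summit = problem name (single-conjunct summit), D-0017

open Real Finset Literature.MathematicalPhysics.QuantumLattice Literature.Probability.LatticeModels
open Literature.MathematicalPhysics.QuantumLattice.FermiRG

/-! ## §1 Lattice bridges -/

section Lattice

variable (L : ℕ) [NeZero L]

omit [NeZero L] in
/-- The continuum free band at a lattice momentum is the torus band. -/
theorem freeBandFn_latticeMomentum (k : TorusSite 2 L) : freeBandFn (latticeMomentum L k) = torusBand L k := by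
  simp [freeBandFn, torusBand, Fin.sum_univ_two]

/-- The continuum flat cutoff at a lattice momentum is the lattice flat cutoff. -/
theorem klFlatCutoffFn_latticeMomentum (μ : ℝ) (k : TorusSite 2 L) : klFlatCutoffFn μ (latticeMomentum L k) = klFlatCutoff L μ k := by
  simp [klFlatCutoffFn, klFlatCutoff, nambuXi, freeBandFn_latticeMomentum]

omit [NeZero L] in
/-- The centred representative of a lattice momentum is the torus's centred momentum. -/
theorem centredRep_latticeMomentum (k : TorusSite 2 L) : centredRep (latticeMomentum L k) = torusCentredMomentum L k := rfl

omit [NeZero L] in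
/-- The polar angle of the centred representative of a lattice momentum is `momentumAngle`. -/
theorem polarAngle_centredRep_latticeMomentum (k : TorusSite 2 L) :
    polarAngle (centredRep (latticeMomentum L k)) = momentumAngle L k := rfl

/-- **At a lattice momentum the de-interpolated G-extension takes the lattice datum of `klFrameExtG`.** -/
theorem klFrameExtFn_latticeMomentum (μ : ℝ) (f : ℝ → ℝ) (k : TorusSite 2 L) :
    klFrameExtFn μ f (latticeMomentum L k) = klAngularMean f + klFlatCutoff L μ k * (f (momentumAngle L k) - klAngularMean f) := by
  rw [klFrameExtFn, klFlatCutoffFn_latticeMomentum, polarAngle_centredRep_latticeMomentum]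

/-- **The model's view of the new piece is the old piece**: `toTrigPoly L (klFrameExtFn μ f) = klFrameExtG L μ f`. -/
theorem toTrigPoly_klFrameExtFn (μ : ℝ) (f : ℝ → ℝ) : toTrigPoly L (klFrameExtFn μ f) = klFrameExtG L μ f := by
  unfold toTrigPoly klFrameExtG
  congr 1
  funext k
  exact klFrameExtFn_latticeMomentum L μ f k

/-- **A `TrigPolyC4v` frame and its re-interpolated view have the same renormalised band** (every model object reads only `nambuXiCT`). -/
theorem nambuXiCT_toTrigPoly_eval (μ : ℝ) (K : TrigPolyC4v) : nambuXiCT L μ (toTrigPoly L K.eval) = nambuXiCT L μ K := by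
  funext k
  rw [nambuXiCT_toTrigPoly L (isSymmetricFrame_eval K), nambuXiCT]

/-- The band of a symmetric frame's model view, as the free band datum: `e_K(k) = ξ_μ(k) − K(p_k)`. -/
theorem nambuXiCT_toTrigPoly_eq_nambuXi_sub {K : FrameFn} (hK : IsSymmetricFrame K) (μ : ℝ) (k : TorusSite 2 L) :
    nambuXiCT L μ (toTrigPoly L K) k = nambuXi L μ k - K (latticeMomentum L k) := by
  rw [nambuXiCT_toTrigPoly L hK, nambuXi]

end Lattice

/-! ## §2 The flat cutoff on continuum momenta -/

/-- **On the flat tube the cutoff is `1`**: `|ε(p) − μ| ≤ klFlatR ⇒ klFlatCutoffFn μ p = 1`. -/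
theorem klFlatCutoffFn_eq_one_of_abs_le {μ : ℝ} {p : Fin 2 → ℝ} (h : |freeBandFn p - μ| ≤ klFlatR) : klFlatCutoffFn μ p = 1 := by
  unfold klFlatCutoffFn
  have hR := klFlatR_pos
  have hsq : (freeBandFn p - μ) ^ 2 ≤ klFlatR ^ 2 := sq_le_sq' (abs_le.1 h).1 (abs_le.1 h).2
  have hx : (freeBandFn p - μ) ^ 2 / (4 * klFlatR ^ 2) ≤ 1 / 4 := by
    rw [div_le_iff₀ (by positivity)]
    linarith
  rw [salmhoferCutoff_of_le hx, sub_zero]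

/-- **Off the doubled tube the cutoff is `0`**: `2·klFlatR ≤ |ε(p) − μ| ⇒ klFlatCutoffFn μ p = 0`. -/
theorem klFlatCutoffFn_eq_zero_of_le_abs {μ : ℝ} {p : Fin 2 → ℝ} (h : 2 * klFlatR ≤ |freeBandFn p - μ|) : klFlatCutoffFn μ p = 0 := by
  unfold klFlatCutoffFn
  have hR := klFlatR_pos
  have hsq : (2 * klFlatR) ^ 2 ≤ (freeBandFn p - μ) ^ 2 := by
    have h0 : 0 ≤ 2 * klFlatR := by linarith
    calc (2 * klFlatR) ^ 2 ≤ |freeBandFn p - μ| ^ 2 := pow_le_pow_left₀ h0 h 2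
      _ = (freeBandFn p - μ) ^ 2 := sq_abs _
  have hx : 1 ≤ (freeBandFn p - μ) ^ 2 / (4 * klFlatR ^ 2) := by
    rw [le_div_iff₀ (by positivity)]
    linarith
  rw [salmhoferCutoff_of_ge hx, sub_self]

/-- The cutoff takes values in `[0, 1]`. -/
theorem klFlatCutoffFn_mem_Icc (μ : ℝ) (p : Fin 2 → ℝ) : klFlatCutoffFn μ p ∈ Set.Icc (0 : ℝ) 1 := by
  unfold klFlatCutoffFn
  have h := salmhoferCutoff_mem_Icc ((freeBandFn p - μ) ^ 2 / (4 * klFlatR ^ 2))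
  constructor <;> linarith [h.1, h.2]

/-- The free band is bounded: `|ε(p)| ≤ 4`. -/
theorem abs_freeBandFn_le (p : Fin 2 → ℝ) : |freeBandFn p| ≤ 4 := by
  unfold freeBandFn
  have h0 := Real.abs_cos_le_one (p 0)
  have h1 := Real.abs_cos_le_one (p 1)
  rw [abs_le] at h0 h1 ⊢
  constructor <;> linarith [h0.1, h0.2, h1.1, h1.2]

/-! ## §3 Pointwise algebra of `klFrameExtFn` -/

/-- **On the flat tube the G-extension IS the angular profile**: `klFlatCutoffFn μ p = 1 ⇒ klFrameExtFn μ f p = f (polarAngle p̃)` — at EVERY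
continuum momentum of the tube (the status-quo `klFrameExtG` had this only at lattice momenta, `symInterp_eval_latticeMomentum`). -/
theorem klFrameExtFn_apply_of_cutoff_eq_one {μ : ℝ} (f : ℝ → ℝ) {p : Fin 2 → ℝ} (h : klFlatCutoffFn μ p = 1) :
    klFrameExtFn μ f p = f (polarAngle (centredRep p)) := by
  rw [klFrameExtFn, h]; ring

/-- On the flat tube, in terms of the band: `|ε(p) − μ| ≤ klFlatR ⇒ klFrameExtFn μ f p = f (polarAngle p̃)`. -/
theorem klFrameExtFn_apply_of_flat {μ : ℝ} (f : ℝ → ℝ) {p : Fin 2 → ℝ} (h : |freeBandFn p - μ| ≤ klFlatR) :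
    klFrameExtFn μ f p = f (polarAngle (centredRep p)) :=
  klFrameExtFn_apply_of_cutoff_eq_one f (klFlatCutoffFn_eq_one_of_abs_le h)

/-- Off the doubled tube the G-extension is the angular mean. -/
theorem klFrameExtFn_apply_of_far {μ : ℝ} (f : ℝ → ℝ) {p : Fin 2 → ℝ} (h : 2 * klFlatR ≤ |freeBandFn p - μ|) :
    klFrameExtFn μ f p = klAngularMean f := by
  rw [klFrameExtFn, klFlatCutoffFn_eq_zero_of_le_abs h]; ring

/-- **The G-extension of a constant profile is the constant frame.** -/
theorem klFrameExtFn_const (μ c : ℝ) : klFrameExtFn μ (fun _ => c) = fun _ => c := by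
  funext p
  rw [klFrameExtFn, klAngularMean_const]; ring

/-- The G-extension of the zero profile vanishes. -/
theorem klFrameExtFn_zero (μ : ℝ) : klFrameExtFn μ (fun _ => (0 : ℝ)) = fun _ => 0 := klFrameExtFn_const μ 0

/-- **Additivity** (profiles integrable on `[0, 2π]`). -/
theorem klFrameExtFn_add (μ : ℝ) {f g : ℝ → ℝ} (hf : IntervalIntegrable f MeasureTheory.volume 0 (2 * π))
    (hg : IntervalIntegrable g MeasureTheory.volume 0 (2 * π)) :
    klFrameExtFn μ (fun θ => f θ + g θ) = fun p => klFrameExtFn μ f p + klFrameExtFn μ g p := by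
  funext p
  simp only [klFrameExtFn, klAngularMean_add hf hg]
  ring

/-- Negation. -/
theorem klFrameExtFn_neg (μ : ℝ) (f : ℝ → ℝ) : klFrameExtFn μ (fun θ => -f θ) = fun p => -klFrameExtFn μ f p := by
  funext p
  simp only [klFrameExtFn, klAngularMean_neg]
  ring

/-- **Subtraction** (profiles integrable on `[0, 2π]`) — the shape of every two-leg PIECE `D_n − D_{n−1} = klFrameExtFn μ (ν_n − ν_{n−1})`. -/
theorem klFrameExtFn_sub (μ : ℝ) {f g : ℝ → ℝ} (hf : IntervalIntegrable f MeasureTheory.volume 0 (2 * π))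
    (hg : IntervalIntegrable g MeasureTheory.volume 0 (2 * π)) :
    klFrameExtFn μ (fun θ => f θ - g θ) = fun p => klFrameExtFn μ f p - klFrameExtFn μ g p := by
  funext p
  simp only [klFrameExtFn, klAngularMean_sub hf hg]
  ring

/-- Homogeneity. -/
theorem klFrameExtFn_const_mul (μ a : ℝ) (f : ℝ → ℝ) : klFrameExtFn μ (fun θ => a * f θ) = fun p => a * klFrameExtFn μ f p := by
  funext p
  simp only [klFrameExtFn, klAngularMean_const_mul]
  ring

/-- Adding a constant to the profile adds the constant frame. -/
theorem klFrameExtFn_add_const (μ : ℝ) {f : ℝ → ℝ} (hf : IntervalIntegrable f MeasureTheory.volume 0 (2 * π)) (c : ℝ) :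
    klFrameExtFn μ (fun θ => f θ + c) = fun p => klFrameExtFn μ f p + c := by
  rw [klFrameExtFn_add μ hf intervalIntegrable_const, klFrameExtFn_const]

/-- **The mean-free split**: `klFrameExtFn μ f = mean f + klFrameExtFn μ (f − mean f)` with the second profile mean-free. -/
theorem klFrameExtFn_eq_mean_add (μ : ℝ) {f : ℝ → ℝ} (hf : IntervalIntegrable f MeasureTheory.volume 0 (2 * π)) (p : Fin 2 → ℝ) :
    klFrameExtFn μ f p = klAngularMean f + klFrameExtFn μ (fun θ => f θ - klAngularMean f) p := by
  have h := klFrameExtFn_sub μ hf (intervalIntegrable_const (c := klAngularMean f))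
  have h' : klFrameExtFn μ (fun θ => f θ - klAngularMean f) p = klFrameExtFn μ f p - klFrameExtFn μ (fun _ => klAngularMean f) p := by
    rw [h]
  rw [h', klFrameExtFn_const]
  ring

/-- **Sup control**: `|klFrameExtFn μ f p − mean f| ≤ |f (polarAngle p̃) − mean f|` (`χ_flat ∈ [0, 1]`). -/
theorem abs_klFrameExtFn_sub_mean_le (μ : ℝ) (f : ℝ → ℝ) (p : Fin 2 → ℝ) :
    |klFrameExtFn μ f p - klAngularMean f| ≤ |f (polarAngle (centredRep p)) - klAngularMean f| := by
  have h := klFlatCutoffFn_mem_Icc μ p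
  rw [klFrameExtFn, add_sub_cancel_left, abs_mul, abs_of_nonneg h.1]
  exact mul_le_of_le_one_left (abs_nonneg _) h.2

/-- Sup bound: `|klFrameExtFn μ f p| ≤ |mean f| + |f (polarAngle p̃) − mean f|`. -/
theorem abs_klFrameExtFn_le (μ : ℝ) (f : ℝ → ℝ) (p : Fin 2 → ℝ) :
    |klFrameExtFn μ f p| ≤ |klAngularMean f| + |f (polarAngle (centredRep p)) - klAngularMean f| := by
  have h := abs_klFrameExtFn_sub_mean_le μ f p
  have htri : |klFrameExtFn μ f p| ≤ |klAngularMean f| + |klFrameExtFn μ f p - klAngularMean f| := by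
    have := abs_add_le (klAngularMean f) (klFrameExtFn μ f p - klAngularMean f)
    rwa [add_sub_cancel] at this
  linarith

/-- If the profile is within `B` of its mean everywhere, so is its G-extension. -/
theorem abs_klFrameExtFn_sub_mean_le_of_forall (μ : ℝ) {f : ℝ → ℝ} {B : ℝ} (hB : ∀ θ, |f θ - klAngularMean f| ≤ B) (p : Fin 2 → ℝ) :
    |klFrameExtFn μ f p - klAngularMean f| ≤ B :=
  (abs_klFrameExtFn_sub_mean_le μ f p).trans (hB _)

end Summit.HubbardSuperconductivity.HubbardSuperconductivity.Theorems.KLRegimeSplit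

end
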